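import Mathlib

/-!
# `SystemLSDRealSegment` — negative-side support: the divisor bound `Σ_{n ≤ x} 2^{ω(n)} ≥ (x/2) log x - x`

Elementary lower bound used by the standing disprover of the crux
`Summit.Parity.BatemanHorn.Theses.AlmostPrimeZeros.SystemLSDRealSegment` (stmt-Parity-11292) to show that the
fields `irreducible` and `pairwise_not_associated` of `IsBatemanHornSystem` are load-bearing (witnesses `X²` and
`(X, X)`, whose capped statistics dominate `2ω(n)`): `2^{ω(n)} ≥ #{d ∣ n squarefree}`, swap the sums,
`Σ_{d ≤ x sqfree} 1/d ≥ ½ Σ_{n ≤ x} 1/n ≥ ½ log x` (write `n = b²a`). Crude Dirichlet, no asymptotics.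
From `Cruxes/SystemLSDRealSegment/Disproof.lean` §1.
-/

open Finset

namespace Summit.Parity.BatemanHorn.Theorems.SystemLSDRealSegment.Negative

/-- Squarefree divisors inject into subsets of the prime factors: `#{d ∣ n squarefree} ≤ 2^{ω(n)}`. [folklore] -/
theorem card_sqfree_divisors_le (n : ℕ) : (n.divisors.filter Squarefree).card ≤ 2 ^ n.primeFactors.card := by
  rw [← Finset.card_powerset]
  refine Finset.card_le_card_of_injOn (fun d => d.primeFactors) (fun d hd => ?_) (fun d₁ hd₁ d₂ hd₂ heq => ?_)
  · rw [Finset.mem_coe, Finset.mem_filter, Nat.mem_divisors] at hd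
    rw [Finset.mem_coe, Finset.mem_powerset]
    exact Nat.primeFactors_mono hd.1.1 hd.1.2
  · rw [Finset.mem_coe, Finset.mem_filter] at hd₁ hd₂
    calc d₁ = ∏ p ∈ d₁.primeFactors, p := (Nat.prod_primeFactors_of_squarefree hd₁.2).symm
      _ = ∏ p ∈ d₂.primeFactors, p := by simp only at heq; rw [heq]
      _ = d₂ := Nat.prod_primeFactors_of_squarefree hd₂.2

/-- Double counting: `Σ_{1 ≤ n ≤ x} #{d ∣ n squarefree} = Σ_{d ≤ x squarefree} ⌊x/d⌋`. [folklore] -/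
theorem sum_card_sqfree_divisors (x : ℕ) :
    ∑ n ∈ Icc 1 x, (n.divisors.filter Squarefree).card = ∑ d ∈ (Icc 1 x).filter Squarefree, x / d := by
  have hL : ∀ n ∈ Icc 1 x, (n.divisors.filter Squarefree).card =
      ∑ d ∈ (Icc 1 x).filter Squarefree, if d ∣ n then 1 else 0 := by
    intro n hn
    rw [Finset.mem_Icc] at hn
    rw [← Finset.card_filter]
    congr 1
    ext d
    simp only [Finset.mem_filter, Nat.mem_divisors, Finset.mem_Icc]
    constructor
    · rintro ⟨⟨hd, -⟩, hsq⟩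
      exact ⟨⟨⟨Nat.pos_of_dvd_of_pos hd (by omega), (Nat.le_of_dvd (by omega) hd).trans hn.2⟩, hsq⟩, hd⟩
    · rintro ⟨⟨-, hsq⟩, hd⟩
      exact ⟨⟨hd, by omega⟩, hsq⟩
  have hIcc : Icc 1 x = Ioc 0 x := by
    ext n; simp only [Finset.mem_Icc, Finset.mem_Ioc]; omega
  have hR : ∀ d ∈ (Icc 1 x).filter Squarefree, x / d = ∑ n ∈ Icc 1 x, if d ∣ n then 1 else 0 := by
    intro d _
    rw [← Finset.card_filter, hIcc, Nat.Ioc_filter_dvd_card_eq_div]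
  rw [Finset.sum_congr rfl hL, Finset.sum_congr rfl hR, Finset.sum_comm]

/-- Writing `n = b² a` with `a` squarefree: `Σ_{n ≤ x} 1/n ≤ 2 Σ_{a ≤ x squarefree} 1/a`. [folklore] -/
theorem sum_inv_le_two_mul_sum_sqfree_inv (x : ℕ) :
    ∑ n ∈ Icc 1 x, (1 : ℝ) / n ≤ 2 * ∑ d ∈ (Icc 1 x).filter Squarefree, (1 : ℝ) / d := by
  classical
  have sum_inv_sq_Icc_le_two : ∑ b ∈ Icc 1 x, 1 / (b : ℝ) ^ 2 ≤ 2 := by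
    have hsub : Icc 1 x ⊆ insert 1 (Ioo 1 (x + 1)) := by
      intro b hb
      simp only [Finset.mem_insert, Finset.mem_Ioo, Finset.mem_Icc] at hb ⊢
      omega
    have h1 : (1 : ℕ) ∉ Ioo 1 (x + 1) := by simp
    have hIoo : ∑ b ∈ Ioo 1 (x + 1), 1 / (b : ℝ) ^ 2 ≤ 1 := by
      have := sum_Ioo_inv_sq_le (α := ℝ) 1 (x + 1)
      norm_num at this
      simpa only [one_div] using this
    calc ∑ b ∈ Icc 1 x, 1 / (b : ℝ) ^ 2 ≤ ∑ b ∈ insert 1 (Ioo 1 (x + 1)), 1 / (b : ℝ) ^ 2 :=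
          Finset.sum_le_sum_of_subset_of_nonneg hsub fun _ _ _ => by positivity
      _ = 1 + ∑ b ∈ Ioo 1 (x + 1), 1 / (b : ℝ) ^ 2 := by rw [Finset.sum_insert h1]; norm_num
      _ ≤ 1 + 1 := by linarith
      _ = 2 := by norm_num
  have hdec : ∀ n : ℕ, ∃ ab : ℕ × ℕ, 0 < n → (0 < ab.1 ∧ 0 < ab.2 ∧ ab.2 ^ 2 * ab.1 = n ∧ Squarefree ab.1) := by
    intro n
    rcases Nat.eq_zero_or_pos n with h | h
    · exact ⟨(1, 1), fun h' => by omega⟩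
    · obtain ⟨a, b, ha, hb, hab, hsq⟩ := Nat.sq_mul_squarefree_of_pos h
      exact ⟨(a, b), fun _ => ⟨ha, hb, hab, hsq⟩⟩
  choose φ hφ using hdec
  set A := (Icc 1 x).filter Squarefree with hA
  set g : ℕ × ℕ → ℝ := fun q => 1 / (q.1 : ℝ) * (1 / (q.2 : ℝ) ^ 2) with hg
  have hmaps : ∀ n ∈ Icc 1 x, φ n ∈ A ×ˢ Icc 1 x := by
    intro n hn
    rw [Finset.mem_Icc] at hn
    obtain ⟨ha, hb, hab, hsq⟩ := hφ n (by omega)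
    rw [Finset.mem_product, hA, Finset.mem_filter, Finset.mem_Icc, Finset.mem_Icc]
    refine ⟨⟨⟨ha, ?_⟩, hsq⟩, hb, ?_⟩
    · calc (φ n).1 ≤ (φ n).2 ^ 2 * (φ n).1 := Nat.le_mul_of_pos_left _ (by positivity)
        _ = n := hab
        _ ≤ x := hn.2
    · calc (φ n).2 ≤ (φ n).2 ^ 2 := Nat.le_self_pow (by norm_num) _
        _ ≤ (φ n).2 ^ 2 * (φ n).1 := Nat.le_mul_of_pos_right _ ha
        _ = n := hab
        _ ≤ x := hn.2
  have hinj : Set.InjOn φ (Icc 1 x : Finset ℕ) := by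
    intro n hn m hm heq
    rw [Finset.mem_coe, Finset.mem_Icc] at hn hm
    obtain ⟨-, -, habn, -⟩ := hφ n (by omega)
    obtain ⟨-, -, habm, -⟩ := hφ m (by omega)
    rw [← habn, ← habm, heq]
  have hterm : ∀ n ∈ Icc 1 x, (1 : ℝ) / n = g (φ n) := by
    intro n hn
    rw [Finset.mem_Icc] at hn
    obtain ⟨ha, hb, hab, -⟩ := hφ n (by omega)
    have ha' : ((φ n).1 : ℝ) ≠ 0 := by exact_mod_cast ha.ne'
    have hb' : ((φ n).2 : ℝ) ≠ 0 := by exact_mod_cast hb.ne'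
    have hn' : (n : ℝ) = ((φ n).2 : ℝ) ^ 2 * (φ n).1 := by exact_mod_cast hab.symm
    rw [hg]
    simp only
    rw [hn']
    field_simp
  calc ∑ n ∈ Icc 1 x, (1 : ℝ) / n = ∑ n ∈ Icc 1 x, g (φ n) := Finset.sum_congr rfl hterm
    _ = ∑ q ∈ (Icc 1 x).image φ, g q := (Finset.sum_image hinj).symm
    _ ≤ ∑ q ∈ A ×ˢ Icc 1 x, g q := by
        apply Finset.sum_le_sum_of_subset_of_nonneg
        · intro q hq
          rw [Finset.mem_image] at hq
          obtain ⟨n, hn, rfl⟩ := hq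
          exact hmaps n hn
        · intro q _ _
          rw [hg]; positivity
    _ = (∑ a ∈ A, (1 : ℝ) / a) * ∑ b ∈ Icc 1 x, 1 / (b : ℝ) ^ 2 := by
        rw [Finset.sum_mul_sum, Finset.sum_product]
    _ ≤ (∑ a ∈ A, (1 : ℝ) / a) * 2 := by
        have : 0 ≤ ∑ a ∈ A, (1 : ℝ) / a := Finset.sum_nonneg fun _ _ => by positivity
        exact mul_le_mul_of_nonneg_left sum_inv_sq_Icc_le_two this
    _ = 2 * ∑ d ∈ A, (1 : ℝ) / d := mul_comm _ _

/-- `log x ≤ Σ_{n ≤ x} 1/n`. [folklore] -/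
theorem log_le_sum_inv (x : ℕ) : Real.log x ≤ ∑ n ∈ Icc 1 x, (1 : ℝ) / n := by
  rcases Nat.eq_zero_or_pos x with rfl | hx
  · simp
  have h := log_add_one_le_harmonic x
  have hmono : Real.log x ≤ Real.log ((x + 1 : ℕ) : ℝ) :=
    Real.log_le_log (by exact_mod_cast hx) (by push_cast; linarith)
  refine hmono.trans (h.trans (le_of_eq ?_))
  rw [harmonic_eq_sum_Icc]
  push_cast
  simp [one_div]

/-- THE DIVISOR BOUND: `(x/2) log x - x ≤ Σ_{1 ≤ n ≤ x} 2^{ω(n)}` (crude Dirichlet: `2^{ω(n)} ≥ #` squarefree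
divisors, swap, `Σ_{d sqfree} 1/d ≥ ½ Σ 1/n ≥ ½ log x`). [folklore] -/
theorem sum_two_pow_omega_ge (x : ℕ) :
    (x : ℝ) / 2 * Real.log x - x ≤ ∑ n ∈ Icc 1 x, (2 : ℝ) ^ n.primeFactors.card := by
  set A := (Icc 1 x).filter Squarefree with hA
  have h1 : ∑ n ∈ Icc 1 x, ((n.divisors.filter Squarefree).card : ℝ) ≤
      ∑ n ∈ Icc 1 x, (2 : ℝ) ^ n.primeFactors.card := by
    refine Finset.sum_le_sum fun n _ => ?_
    exact_mod_cast card_sqfree_divisors_le n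
  have h2 : ∑ n ∈ Icc 1 x, ((n.divisors.filter Squarefree).card : ℝ) = ∑ d ∈ A, ((x / d : ℕ) : ℝ) := by
    rw [hA]; exact_mod_cast congrArg (Nat.cast : ℕ → ℝ) (sum_card_sqfree_divisors x)
  have h3 : ∑ d ∈ A, ((x : ℝ) / d - 1) ≤ ∑ d ∈ A, ((x / d : ℕ) : ℝ) := by
    refine Finset.sum_le_sum fun d hd => ?_
    rw [hA, Finset.mem_filter, Finset.mem_Icc] at hd
    have hb : 0 < d := by omega
    -- `x/d - 1 ≤ ⌊x/d⌋`
    have h := Nat.lt_div_mul_add (a := x) hb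
    have hb' : (0 : ℝ) < d := by exact_mod_cast hb
    rw [sub_le_iff_le_add, div_le_iff₀ hb']
    have : (x : ℝ) < (x / d : ℕ) * d + d := by exact_mod_cast h
    linarith
  have h4 : ∑ d ∈ A, ((x : ℝ) / d - 1) = x * ∑ d ∈ A, (1 : ℝ) / d - A.card := by
    rw [Finset.sum_sub_distrib, Finset.mul_sum, Finset.sum_const, nsmul_eq_mul, mul_one]
    congr 1
    exact Finset.sum_congr rfl fun d _ => (mul_one_div (x : ℝ) d).symm
  have h5 : (A.card : ℝ) ≤ x := by
    have : A.card ≤ (Icc 1 x).card := Finset.card_filter_le _ _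
    simp only [Nat.card_Icc, add_tsub_cancel_right] at this
    exact_mod_cast this
  have h6 := sum_inv_le_two_mul_sum_sqfree_inv x
  rw [← hA] at h6
  have h7 := log_le_sum_inv x
  have hx0 : (0 : ℝ) ≤ x := Nat.cast_nonneg x
  have h8 : (x : ℝ) / 2 * Real.log x ≤ x * ∑ d ∈ A, (1 : ℝ) / d := by
    have := mul_le_mul_of_nonneg_left (h7.trans h6) (by positivity : (0 : ℝ) ≤ x / 2)
    have e : (x : ℝ) / 2 * (2 * ∑ d ∈ A, (1 : ℝ) / d) = x * ∑ d ∈ A, (1 : ℝ) / d := by ring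
    linarith
  linarith

end Summit.Parity.BatemanHorn.Theorems.SystemLSDRealSegment.Negative
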